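import Summits.QuantumFields.BalabanUV.Beta.FP.CubicGermPairing
import Summits.QuantumFields.BalabanUV.Beta.WilsonDivergenceContact

/-!
# `BalabanUV.Beta.FP.CubicGermWard` — road «FP» for binder row D1, sub-row H2-G-WARD-BRIDGE of row H2-G (owner b2b-balaban-beta-d1-p3; `LEAVES-FP.md` row H2-G:
# «… + tree-level Ward of the effective action at germ level ⟹ germ(V*) = cQ·ymGerm»), PART 2 of 2: A LATTICE DIVERGENCE (WARD) LAW OF A LOCALISED CUBIC STENCIL
# FAMILY IMPLIES THE GERM-LEVEL WARD IDENTITY `WardGerm (cubicGermOf S) (c · quadMomentOf M)` AGAINST THE QUADRATIC GERM OF THE HESSIAN BLOCK `M`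

HONEST DEPENDENCY (page 1, mandatory): continuum YM on T⁴ ⇐ BetaPertH ∧ nine spine estimates (0/9 proved); BetaPertH ⇐ (D1) ∧ (D4) ∧ CAP+tail;
G-an2-4 gates asym, D1 and NE2/3/4.  HONEST FRAMING (cell contract, verbatim): «discharging `BetaPertH` makes Bałaban's UV stability UNCONDITIONAL —
a real constructive-QFT result; it is NOT the continuum limit and NOT the Clay problem.»  THIS MODULE DISCHARGES NOTHING of the wall: `ℓ¹` bookkeeping on `ℤ⁴ × ℤ⁴`
plus finite index algebra ([folklore]; PART 1 `FP/CubicGermPairing`, an2's `KernelWard.divV`, `FP/StencilMoments`, `FP/WardNormalisation`, `FP/MarginalUniquenessWardMinimal`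
BY NAME).  It proves the Ward law FOR NO effective or perfect stencil (that is H2-V ∕ the slot rows' business): it turns such a law, once supplied, into the germ
hypothesis `WardGerm` consumed by `FP/MarginalUniqueness*`.  No cite, no `def`, no `def … : Prop`, 0 sorry (the data definitions `pairOf`, `linW`, `quadW`, `quadMomentOf`,
`quadRowMomentOf` live in PART 1).  NOT H2-G proper, NOT hasym, NOT D1, NOT BetaPertH, NOT continuum, NOT Clay.

ABSOLUTE RULE (cell charter, verbatim): «No internally-minted statement may enter as a cited fact. Every hypothesis is either kernel-proved in this package or a
verbatim quotation of a PUBLISHED theorem with page reference. The manuscript(s) under audit are NOT citable for their own disputed steps — they are the thing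
under adjudication; programme-internal (2001/route/tribunal) claims are never citable.»

THE STATEMENT (`wardGerm_cubicGermOf_of_law`).  Let `S : Fin 4 → ℤ⁴ → MKer 4 (Fib 3)` be a first-order stencil family with
(h1) `LocStencil S Cs δ`, `0 < δ` (an2's class);  (h2) translation covariance `S λ v = shiftK (−v) (S λ 0)` (the shape of an2's `wilsonA_translate`);
(h3) THE DIVERGENCE LAW at the background site `0`, field–field entries: `divV S 0 x z (inl μ) (inl ν) = c · M x z (inl μ) (inl ν) · ([z = 0] − [x = 0])` — exactly the
    `(inl,inl)` entry of an2's commutator form `divV S 0 = c • conjV (ffK M) (diagK (legInd ρ 0))` (`law_of_conjV`);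
(h4) the column and the row of `M` through `0` are exponentially localised (`col_row_of_decays`: `Decays M CM δM` suffices);
(h5) the zeroth moment of `S` vanishes, `∑'_{(x,z)} S λ 0 x z (inl μ) (inl ν) = 0` (`tsum_zeroth_eq_col`: it equals `−c ×` the first column moment of `M`, so it
    vanishes iff that does, `tsum_zeroth_eq_zero_of_col`).
THEN **`WardGerm (cubicGermOf S) (fun k μ ν => c * quadMomentOf M k μ ν)`**, `quadMomentOf M k μ ν = −½ ∑'_x M x 0 (inl μ) (inl ν) (Σ_κ k_κ x_κ)²` = the quadratic
(second-moment) germ of the Hessian's field–field block — so the coefficient `cQ` of row H2-G IS `c ×` Δ's germ coefficient.  By-products: the row quadratic germ of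
`M` equals the column one (`quadRowMomentOf_eq`); (W5) `cubicGermOf S μ ν a b 1 = −cubicGermOf S μ ν b a 0` (`cubicGermOf_snd_eq_neg_transpose`).
COROLLARY `cubicGermOf_eq_of_law_anti13` (`MarginalUniquenessWardMinimal.cubic_eq_of_anti13_ward_general` BY NAME): if moreover `c · quadMomentOf M = quadGerm cQ α γ`
(B₄-isotropy of the Hessian's quadratic germ) and `Anti13 (cubicGermOf S)`, then `cubicGermOf S = cQ · ymGerm` and `α = γ = 0`.

MECHANISM (the test-polynomial argument made honest).  §1 PAIRING LAW: for every weight `|φ x z| ≤ A(|x|₁+1)^k(|z|₁+1)^k`,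
  `Σ_λ (pairOf S λ μ ν φ(· − e_λ, · − e_λ) − pairOf S λ μ ν φ) = c·(∑'_x M x 0 φ(x,0) − ∑'_z M 0 z φ(0,z))`
((h3) multiplied by `φ` and summed: (h2) + `CubicGermPairing.tsum_shift_eq_pairOf`, summability from `CubicGermPairing.summable_pairOf(_shift)`, the slices `[z = 0]` ∕
`[x = 0]` by `Function.Injective.hasSum_iff`, `HasSum.unique`).  §3: at the weight `quadW p q = ½(p·x + q·z)²` (`CubicGermPairing.quadW_shift`, `pairOf_linW`) the left
side is the `WardGerm` left side (the zeroth moment drops by (h5)), the right side is `c·(quadRowMomentOf M q − quadMomentOf M p)`; `CubicGermPairing.wardGerm_of_twoGerm`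
identifies the two quadratic germs and yields `WardGerm`.
INSTANCE CHECK (§5): an2's level-0 Wilson table `wilsonA 3` with `c = ½`, `M = bhK 1` (the `d*d` window; `WilsonDivergenceContact.divV_wilsonA_inl_inl`,
`locStencil_wilsonA`, `wilsonA_translate`, `decays_bhK`, `WilsonCubicGerm.tsum_wilsonA_eq_zero` BY NAME) satisfies (h1)–(h5): `wardGerm_wilsonA_of_law`; compared with
p236459's `wardGerm_wilsonA` (`CubicGermPairing.quad_eq_of_wardGerm`): the COMPUTED normalisation `½ · quadMomentOf (bhK 1) k μ ν = quadGerm 1 0 0 k μ ν` (`half_quadMomentOf_bhK`).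
v1.1 (same seat): + `tsum_bhK_fst_moment_eq_zero` — the `d*d` window has no first column moment (letter (h5) at level 0), read off `tsum_wilsonA_eq_zero`.
Provenance: G-an2-4 formalisation swarm seat b2b-balaban-gan24-formalise-leaf-02 gen 37 (cross-lane on road FP), 2026-08-20.
-/

noncomputable section

namespace Summit.QuantumFields.BalabanUV.Beta.FP.CubicGermWard

open Finset
open scoped BigOperators
open Literature.MathematicalPhysics.QuantumFieldTheory.Balaban1983to89
open Literature.MathematicalPhysics.QuantumFieldTheory.Balaban1983to89.Beta
open Literature.MathematicalPhysics.QuantumFieldTheory.Balaban1983to89.B12Sec2to5 (l1 l1_nonneg)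
open Literature.MathematicalPhysics.QuantumFieldTheory.Balaban1983to89.B6BondElimination (unitVec unitVec_apply)
open Literature.MathematicalPhysics.QuantumFieldTheory.Balaban1983to89.Beta.ExpKernelCalculus (Site MKer BiLoc Decays shiftK l1_sub_symm)
open Literature.MathematicalPhysics.QuantumFieldTheory.Balaban1983to89.Beta.OneStepResolventKernel (Fib LocStencil)
open Literature.MathematicalPhysics.QuantumFieldTheory.Balaban1983to89.Beta.KernelWard (divV)
open Literature.MathematicalPhysics.QuantumFieldTheory.Balaban1983to89.Beta.StepJetData (wilsonA locStencil_wilsonA wBound wilsonA_translate)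
open Summit.QuantumFields.BalabanUV.Beta.ChartConjugation (conjV)
open Summit.QuantumFields.BalabanUV.Beta.BorderedHessian (diagK bhK bhK_inl_inl_eq conjV_diagK_apply decays_bhK)
open Summit.QuantumFields.BalabanUV.Beta.AveragingWardRootedStencils (legInd legInd_inl)
open Summit.QuantumFields.BalabanUV.Beta.WardLocusStencils (ffK ffK_inl_inl divV_apply)
open Summit.QuantumFields.BalabanUV.Beta.WilsonDivergenceContact (divV_wilsonA_inl_inl)
open Summit.QuantumFields.BalabanUV.Beta.FP.StencilMoments (summable_of_weight_exp)
open Summit.QuantumFields.BalabanUV.Beta.FP.MarginalUniqueness (Idx CubicGerm ymGerm Anti13)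
open Summit.QuantumFields.BalabanUV.Beta.FP.WardNormalisation (WardGerm quadGerm)
open Summit.QuantumFields.BalabanUV.Beta.FP.MarginalUniquenessWardMinimal (cubic_eq_of_anti13_ward_general quadGerm_zero)
open Summit.QuantumFields.BalabanUV.Beta.FP.WilsonCubicGerm (cubicGermOf cubicGermOf_wilsonA wardGerm_wilsonA tsum_wilsonA_eq_zero)
open Summit.QuantumFields.BalabanUV.Beta.FP.CubicGermPairing

/-! ## §1 The pairing law: the divergence law summed against a polynomial weight -/

section Law

variable {S : Fin 4 → Site 4 → MKer 4 (Fib 3)} {Cs δ c CM δM : ℝ} {M : MKer 4 (Fib 3)}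

/-- [folklore] under translation covariance, the divergence at the background site `0` reads through the member `S λ 0` at shifted legs:
`divV S 0 x z a b = Σ_λ (S λ 0 (x + e_λ) (z + e_λ) a b − S λ 0 x z a b)`. -/
theorem divV_zero_apply (hcov : ∀ (lam : Fin 4) (v : Site 4), S lam v = shiftK (-v) (S lam 0)) (x z : Site 4) (a b : Fib 3) :
    divV S 0 x z a b = ∑ lam, (S lam 0 (x + unitVec lam) (z + unitVec lam) a b - S lam 0 x z a b) := by
  rw [divV_apply]
  refine Finset.sum_congr rfl fun lam _ => ?_
  rw [hcov lam (0 - unitVec lam)]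
  simp [shiftK]

/-- [folklore] the column of `M` through `0` is summable against a polynomial weight. -/
theorem summable_col (hMcol : ∀ (x : Site 4) (μ ν : Fin 4), |M x 0 (Sum.inl μ) (Sum.inl ν)| ≤ CM * Real.exp (-δM * l1 x)) (hδM : 0 < δM)
    {φ : Site 4 → Site 4 → ℝ} {A : ℝ} {k : ℕ} (hA : 0 ≤ A) (hφ : ∀ x z, |φ x z| ≤ A * ((l1 x + 1) ^ k * (l1 z + 1) ^ k)) (μ ν : Fin 4) :
    Summable fun x : Site 4 => M x 0 (Sum.inl μ) (Sum.inl ν) * φ x 0 := by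
  have l10 : l1 (0 : Site 4) = 0 := by simp [l1]
  have hCM : 0 ≤ CM := by
    have h := hMcol 0 μ ν
    rw [l10, mul_zero, Real.exp_zero, mul_one] at h
    exact (abs_nonneg _).trans h
  refine (summable_of_weight_exp (q := (0 : Site 4)) (k := k) hδM (mul_nonneg hCM hA)
    (g := fun x => M x 0 (Sum.inl μ) (Sum.inl ν) * φ x 0) fun x => ?_).1
  have h2 := hφ x 0
  rw [l10, zero_add, one_pow, mul_one] at h2
  rw [sub_zero, abs_mul]
  calc |M x 0 (Sum.inl μ) (Sum.inl ν)| * |φ x 0| ≤ (CM * Real.exp (-δM * l1 x)) * (A * (l1 x + 1) ^ k) :=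
        mul_le_mul (hMcol x μ ν) h2 (abs_nonneg _) (by positivity)
    _ = CM * A * (l1 x + 1) ^ k * Real.exp (-δM * l1 x) := by ring

/-- [folklore] the row of `M` through `0` is summable against a polynomial weight. -/
theorem summable_row (hMrow : ∀ (z : Site 4) (μ ν : Fin 4), |M 0 z (Sum.inl μ) (Sum.inl ν)| ≤ CM * Real.exp (-δM * l1 z)) (hδM : 0 < δM)
    {φ : Site 4 → Site 4 → ℝ} {A : ℝ} {k : ℕ} (hA : 0 ≤ A) (hφ : ∀ x z, |φ x z| ≤ A * ((l1 x + 1) ^ k * (l1 z + 1) ^ k)) (μ ν : Fin 4) :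
    Summable fun z : Site 4 => M 0 z (Sum.inl μ) (Sum.inl ν) * φ 0 z := by
  have l10 : l1 (0 : Site 4) = 0 := by simp [l1]
  have hCM : 0 ≤ CM := by
    have h := hMrow 0 μ ν
    rw [l10, mul_zero, Real.exp_zero, mul_one] at h
    exact (abs_nonneg _).trans h
  refine (summable_of_weight_exp (q := (0 : Site 4)) (k := k) hδM (mul_nonneg hCM hA)
    (g := fun z => M 0 z (Sum.inl μ) (Sum.inl ν) * φ 0 z) fun z => ?_).1
  have h2 := hφ 0 z
  rw [l10, zero_add, one_pow, one_mul] at h2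
  rw [sub_zero, abs_mul]
  calc |M 0 z (Sum.inl μ) (Sum.inl ν)| * |φ 0 z| ≤ (CM * Real.exp (-δM * l1 z)) * (A * (l1 z + 1) ^ k) :=
        mul_le_mul (hMrow z μ ν) h2 (abs_nonneg _) (by positivity)
    _ = CM * A * (l1 z + 1) ^ k * Real.exp (-δM * l1 z) := by ring

variable (hS : LocStencil S Cs δ) (hδ : 0 < δ) (hcov : ∀ (lam : Fin 4) (v : Site 4), S lam v = shiftK (-v) (S lam 0))
  (hlaw : ∀ (x z : Site 4) (μ ν : Fin 4), divV S 0 x z (Sum.inl μ) (Sum.inl ν) =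
    c * M x z (Sum.inl μ) (Sum.inl ν) * ((if z = 0 then (1 : ℝ) else 0) - (if x = 0 then (1 : ℝ) else 0)))
  (hMcol : ∀ (x : Site 4) (μ ν : Fin 4), |M x 0 (Sum.inl μ) (Sum.inl ν)| ≤ CM * Real.exp (-δM * l1 x))
  (hMrow : ∀ (z : Site 4) (μ ν : Fin 4), |M 0 z (Sum.inl μ) (Sum.inl ν)| ≤ CM * Real.exp (-δM * l1 z)) (hδM : 0 < δM)
include hS hδ hcov hlaw hMcol hMrow hδM

/-- [folklore] **THE PAIRING LAW.**  Under (h1) `LocStencil`, (h2) translation covariance, (h3) the divergence law at the background site `0` with constant `c`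
and Hessian block `M`, and (h4) localisation of `M`'s column and row through `0`: for every polynomial weight `φ`,
`Σ_λ (pairOf S λ μ ν φ(· − e_λ, · − e_λ) − pairOf S λ μ ν φ) = c·(∑'_x M x 0 (inl μ) (inl ν) φ(x,0) − ∑'_z M 0 z (inl μ) (inl ν) φ(0,z))`. -/
theorem pairing_law {φ : Site 4 → Site 4 → ℝ} {A : ℝ} {k : ℕ} (hA : 0 ≤ A) (hφ : ∀ x z, |φ x z| ≤ A * ((l1 x + 1) ^ k * (l1 z + 1) ^ k))
    (μ ν : Fin 4) :
    ∑ lam, (pairOf S lam μ ν (fun x z => φ (x - unitVec lam) (z - unitVec lam)) - pairOf S lam μ ν φ) =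
      c * ((∑' x : Site 4, M x 0 (Sum.inl μ) (Sum.inl ν) * φ x 0) - ∑' z : Site 4, M 0 z (Sum.inl μ) (Sum.inl ν) * φ 0 z) := by
  -- the left side: `HasSum` of `(x,z) ↦ divV S 0 x z μ ν · φ x z`
  have hterm : ∀ lam ∈ (Finset.univ : Finset (Fin 4)),
      HasSum (fun xz : Site 4 × Site 4 =>
        (S lam 0 (xz.1 + unitVec lam) (xz.2 + unitVec lam) (Sum.inl μ) (Sum.inl ν) - S lam 0 xz.1 xz.2 (Sum.inl μ) (Sum.inl ν)) * φ xz.1 xz.2)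
        (pairOf S lam μ ν (fun x z => φ (x - unitVec lam) (z - unitVec lam)) - pairOf S lam μ ν φ) := by
    intro lam _
    have h1 := (summable_pairOf_shift hS hδ hA hφ lam μ ν (unitVec lam)).hasSum
    rw [tsum_shift_eq_pairOf S lam μ ν φ (unitVec lam)] at h1
    have h2 := (summable_pairOf hS hδ hA hφ lam μ ν).hasSum
    refine (h1.sub h2).congr_fun fun xz => ?_
    ring
  have hL : HasSum (fun xz : Site 4 × Site 4 => divV S 0 xz.1 xz.2 (Sum.inl μ) (Sum.inl ν) * φ xz.1 xz.2)
      (∑ lam, (pairOf S lam μ ν (fun x z => φ (x - unitVec lam) (z - unitVec lam)) - pairOf S lam μ ν φ)) := by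
    refine (hasSum_sum hterm).congr_fun fun xz => ?_
    rw [divV_zero_apply hcov, Finset.sum_mul]
  -- the right side: the two slices
  have hginj₁ : Function.Injective fun x : Site 4 => (x, (0 : Site 4)) := fun x y h => (Prod.mk.inj h).1
  have hginj₂ : Function.Injective fun z : Site 4 => ((0 : Site 4), z) := fun x y h => (Prod.mk.inj h).2
  have hc : HasSum (fun xz : Site 4 × Site 4 => M xz.1 xz.2 (Sum.inl μ) (Sum.inl ν) * (if xz.2 = 0 then (1 : ℝ) else 0) * φ xz.1 xz.2)
      (∑' x : Site 4, M x 0 (Sum.inl μ) (Sum.inl ν) * φ x 0) := by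
    refine (hginj₁.hasSum_iff ?_).mp ?_
    · intro xz hxz
      have hne : xz.2 ≠ 0 := fun h0 => hxz ⟨xz.1, Prod.ext rfl h0.symm⟩
      simp [hne]
    · refine (summable_col hMcol hδM hA hφ μ ν).hasSum.congr_fun fun x => ?_
      simp
  have hr : HasSum (fun xz : Site 4 × Site 4 => M xz.1 xz.2 (Sum.inl μ) (Sum.inl ν) * (if xz.1 = 0 then (1 : ℝ) else 0) * φ xz.1 xz.2)
      (∑' z : Site 4, M 0 z (Sum.inl μ) (Sum.inl ν) * φ 0 z) := by
    refine (hginj₂.hasSum_iff ?_).mp ?_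
    · intro xz hxz
      have hne : xz.1 ≠ 0 := fun h0 => hxz ⟨xz.2, Prod.ext h0.symm rfl⟩
      simp [hne]
    · refine (summable_row hMrow hδM hA hφ μ ν).hasSum.congr_fun fun z => ?_
      simp
  have hR : HasSum (fun xz : Site 4 × Site 4 => divV S 0 xz.1 xz.2 (Sum.inl μ) (Sum.inl ν) * φ xz.1 xz.2)
      (c * ((∑' x : Site 4, M x 0 (Sum.inl μ) (Sum.inl ν) * φ x 0) - ∑' z : Site 4, M 0 z (Sum.inl μ) (Sum.inl ν) * φ 0 z)) := by
    refine ((hc.sub hr).mul_left c).congr_fun fun xz => ?_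
    rw [hlaw]
    ring
  exact hL.unique hR

/-! ## §2 The zeroth moment of the stencil versus the first column moment of the Hessian block -/

/-- [folklore] **THE ZEROTH MOMENT IS `−c ×` THE FIRST COLUMN MOMENT OF `M`** (the pairing law at the weight `x_κ`):
`∑'_{(x,z)} S κ 0 x z (inl μ) (inl ν) = −c · ∑'_x M x 0 (inl μ) (inl ν) · x_κ`. -/
theorem tsum_zeroth_eq_col (κ μ ν : Fin 4) :
    ∑' xz : Site 4 × Site 4, S κ 0 xz.1 xz.2 (Sum.inl μ) (Sum.inl ν) = -c * ∑' x : Site 4, M x 0 (Sum.inl μ) (Sum.inl ν) * (x κ : ℝ) := by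
  have h := pairing_law hS hδ hcov hlaw hMcol hMrow hδM (φ := fun x _ => (x κ : ℝ)) zero_le_one (abs_fst_le_weight κ) μ ν
  have hw : ∀ lam, pairOf S lam μ ν (fun x _ => (((x - unitVec lam) κ : ℤ) : ℝ)) =
      pairOf S lam μ ν (fun x _ => (x κ : ℝ)) + (-(if κ = lam then (1 : ℝ) else 0)) * pairOf S lam μ ν (fun _ _ => 1) := by
    intro lam
    have hs₂ : Summable fun xz : Site 4 × Site 4 =>
        S lam 0 xz.1 xz.2 (Sum.inl μ) (Sum.inl ν) * (-(if κ = lam then (1 : ℝ) else 0) * 1) := by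
      have h1 := (summable_pairOf hS hδ zero_le_one abs_one_le_weight lam μ ν).mul_left (-(if κ = lam then (1 : ℝ) else 0))
      exact h1.congr fun xz => by ring
    rw [← pairOf_smul, ← pairOf_add lam μ ν (fun x _ => (x κ : ℝ)) (fun _ _ => -(if κ = lam then (1 : ℝ) else 0) * 1)
      (summable_pairOf hS hδ zero_le_one (abs_fst_le_weight κ) lam μ ν) hs₂]
    refine pairOf_congr S lam μ ν fun x z => ?_
    simp only [Pi.sub_apply, unitVec_apply, Int.cast_sub, Int.cast_ite, Int.cast_one, Int.cast_zero]
    ring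
  simp only [hw, add_sub_cancel_left, pairOf_one, neg_mul, Finset.sum_neg_distrib, ite_mul, one_mul, zero_mul, Finset.sum_ite_eq,
    Finset.mem_univ, if_true, Pi.zero_apply, Int.cast_zero, mul_zero, tsum_zero, sub_zero] at h
  linarith

/-- [folklore] HENCE: if the first column moment of `M` vanishes, the zeroth moment of `S` vanishes (hypothesis (h5) from the Hessian side). -/
theorem tsum_zeroth_eq_zero_of_col (hM1 : ∀ (μ ν κ : Fin 4), ∑' x : Site 4, M x 0 (Sum.inl μ) (Sum.inl ν) * (x κ : ℝ) = 0) (lam μ ν : Fin 4) :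
    ∑' xz : Site 4 × Site 4, S lam 0 xz.1 xz.2 (Sum.inl μ) (Sum.inl ν) = 0 := by
  rw [tsum_zeroth_eq_col hS hδ hcov hlaw hMcol hMrow hδM lam μ ν, hM1, mul_zero]

/-! ## §3 The germ-level Ward identity -/

variable (hZ : ∀ (lam μ ν : Fin 4), ∑' xz : Site 4 × Site 4, S lam 0 xz.1 xz.2 (Sum.inl μ) (Sum.inl ν) = 0)
include hZ

/-- [folklore] **THE TWO-GERM IDENTITY** (the pairing law at the quadratic weight; the zeroth moment of `S` drops by (h5)):
`Σ_λ Σ_κ −(p_λ+q_λ)(L⁰_{λκ} p_κ + L¹_{λκ} q_κ) = c·quadRowMomentOf M q − c·quadMomentOf M p`, `L = cubicGermOf S`. -/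
theorem twoGerm_of_law (p q : Fin 4 → ℝ) (μ ν : Fin 4) :
    ∑ lam, ∑ κ, (-(p lam + q lam)) * (cubicGermOf S μ ν lam κ 0 * p κ + cubicGermOf S μ ν lam κ 1 * q κ) =
      c * quadRowMomentOf M q μ ν - c * quadMomentOf M p μ ν := by
  have hA : (0 : ℝ) ≤ (1 / 2 : ℝ) * (((∑ κ, |p κ|) + ∑ κ, |q κ|) ^ 2) := by positivity
  have hB : (0 : ℝ) ≤ (∑ κ, |p κ|) + ∑ κ, |q κ| := by positivity
  have h := pairing_law hS hδ hcov hlaw hMcol hMrow hδM (φ := quadW p q) hA (abs_quadW_le p q) μ ν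
  rw [tsum_col_quadW, tsum_row_quadW] at h
  have hw : ∀ lam, pairOf S lam μ ν (fun x z => quadW p q (x - unitVec lam) (z - unitVec lam)) =
      pairOf S lam μ ν (quadW p q) + (-(p lam + q lam) * ((∑ κ, p κ * cubicGermOf S μ ν lam κ 0) + ∑ κ, q κ * cubicGermOf S μ ν lam κ 1) +
        (1 / 2 : ℝ) * (p lam + q lam) ^ 2 * 0) := by
    intro lam
    have hs₁ : Summable fun xz : Site 4 × Site 4 => S lam 0 xz.1 xz.2 (Sum.inl μ) (Sum.inl ν) * (-(p lam + q lam) * linW p q xz.1 xz.2) := by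
      have h1 := (summable_pairOf hS hδ hB (abs_linW_le p q) lam μ ν).mul_left (-(p lam + q lam))
      exact h1.congr fun xz => by ring
    have hs₂ : Summable fun xz : Site 4 × Site 4 =>
        S lam 0 xz.1 xz.2 (Sum.inl μ) (Sum.inl ν) * ((1 / 2 : ℝ) * (p lam + q lam) ^ 2 * 1) := by
      have h1 := (summable_pairOf hS hδ zero_le_one abs_one_le_weight lam μ ν).mul_left ((1 / 2 : ℝ) * (p lam + q lam) ^ 2)
      exact h1.congr fun xz => by ring
    rw [← hZ lam μ ν, ← pairOf_one, ← pairOf_linW hS hδ, ← pairOf_smul, ← pairOf_smul,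
      ← pairOf_add lam μ ν (fun x z => -(p lam + q lam) * linW p q x z) (fun x z => (1 / 2 : ℝ) * (p lam + q lam) ^ 2 * 1) hs₁ hs₂,
      ← pairOf_add lam μ ν (quadW p q) _ (summable_pairOf hS hδ hA (abs_quadW_le p q) lam μ ν) (hs₁.add hs₂ |>.congr fun xz => by ring)]
    exact pairOf_congr S lam μ ν fun x z => quadW_shift p q x z lam
  simp only [hw, mul_zero, add_zero, add_sub_cancel_left] at h
  have e : ∑ lam, ∑ κ, (-(p lam + q lam)) * (cubicGermOf S μ ν lam κ 0 * p κ + cubicGermOf S μ ν lam κ 1 * q κ) =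
      ∑ lam, -(p lam + q lam) * ((∑ κ, p κ * cubicGermOf S μ ν lam κ 0) + ∑ κ, q κ * cubicGermOf S μ ν lam κ 1) := by
    refine Finset.sum_congr rfl fun lam _ => ?_
    rw [← Finset.sum_add_distrib, Finset.mul_sum]
    refine Finset.sum_congr rfl fun κ _ => ?_
    ring
  rw [e, h]
  ring

/-- [our object] **THE GERM-LEVEL WARD IDENTITY FROM THE LATTICE DIVERGENCE LAW.**  Under (h1) `LocStencil S Cs δ`, `δ > 0`; (h2) translation covariance;
(h3) the divergence law `divV S 0 x z (inl μ) (inl ν) = c·M x z (inl μ) (inl ν)·([z=0] − [x=0])`; (h4) localisation of `M`'s column and row through `0`;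
(h5) vanishing zeroth moment of `S`:  **`WardGerm (cubicGermOf S) (c · quadMomentOf M)`** — the cubic germ of `S` satisfies the tree-level Ward identity
against `c` times the quadratic germ OF THE HESSIAN BLOCK `M`. -/
theorem wardGerm_cubicGermOf_of_law : WardGerm (cubicGermOf S) (fun k μ ν => c * quadMomentOf M k μ ν) :=
  (wardGerm_of_twoGerm (L := cubicGermOf S) (Q₁ := fun k μ ν => c * quadRowMomentOf M k μ ν) (Q₂ := fun k μ ν => c * quadMomentOf M k μ ν)
    (fun μ ν => by simp only [quadRowMomentOf_zero, mul_zero]) (fun μ ν => by simp only [quadMomentOf_zero, mul_zero])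
    (twoGerm_of_law hS hδ hcov hlaw hMcol hMrow hδM hZ)).2

/-- [folklore] BY-PRODUCT: under the law, **the row quadratic germ of `M` equals the column one** (both scaled by `c`). -/
theorem quadRowMomentOf_eq (k : Fin 4 → ℝ) (μ ν : Fin 4) : c * quadRowMomentOf M k μ ν = c * quadMomentOf M k μ ν :=
  (wardGerm_of_twoGerm (L := cubicGermOf S) (Q₁ := fun k μ ν => c * quadRowMomentOf M k μ ν) (Q₂ := fun k μ ν => c * quadMomentOf M k μ ν)
    (fun μ ν => by simp only [quadRowMomentOf_zero, mul_zero]) (fun μ ν => by simp only [quadMomentOf_zero, mul_zero])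
    (twoGerm_of_law hS hδ hcov hlaw hMcol hMrow hδM hZ)).1 k μ ν

/-- [folklore] BY-PRODUCT (W5) for the stencil: `cubicGermOf S μ ν a b 1 = −cubicGermOf S μ ν b a 0`. -/
theorem cubicGermOf_snd_eq_neg_transpose (μ ν a b : Fin 4) : cubicGermOf S μ ν a b 1 = -cubicGermOf S μ ν b a 0 :=
  germ_snd_eq_neg_transpose (wardGerm_cubicGermOf_of_law hS hδ hcov hlaw hMcol hMrow hδM hZ) μ ν a b

/-- [our object] **COROLLARY — «DIVERGENCE LAW + BOSE 1↔3 + ISOTROPIC HESSIAN GERM ⟹ THE GERM IS `cQ·ymGerm`»**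
(`MarginalUniquenessWardMinimal.cubic_eq_of_anti13_ward_general` BY NAME): if moreover `c · quadMomentOf M = quadGerm cQ α γ` (the general
`B₄`-invariant quadratic germ) and `Anti13 (cubicGermOf S)`, then `cubicGermOf S = cQ · ymGerm`, `α = 0`, `γ = 0`. -/
theorem cubicGermOf_eq_of_law_anti13 {cQ α γ : ℝ} (hQ : ∀ k μ ν, c * quadMomentOf M k μ ν = quadGerm cQ α γ k μ ν) (h13 : Anti13 (cubicGermOf S)) :
    (∀ μ ν lam κ i, cubicGermOf S μ ν lam κ i = cQ * ymGerm μ ν lam κ i) ∧ α = 0 ∧ γ = 0 := by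
  have hW := wardGerm_cubicGermOf_of_law hS hδ hcov hlaw hMcol hMrow hδM hZ
  have hW' : WardGerm (cubicGermOf S) (quadGerm cQ α γ) := by
    intro p q μ ν
    have h := hW p q μ ν
    simp only [hQ] at h
    exact h
  exact cubic_eq_of_anti13_ward_general h13 hW'

end Law

/-! ## §4 Bridging lemmas: the hypotheses in the cell's native forms -/

section Bridges

variable {S : Fin 4 → Site 4 → MKer 4 (Fib 3)} {c CM δM : ℝ} {M : MKer 4 (Fib 3)}

/-- [folklore] **(h3) FROM an2's COMMUTATOR FORM**: `divV S 0 = c • conjV (ffK M) (diagK (legInd ρ 0))` ⟹ the entrywise law at the background site `0`. -/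
theorem law_of_conjV (ρ : Site 4) (h : divV S 0 = c • conjV (ffK M) (diagK (legInd ρ 0))) (x z : Site 4) (μ ν : Fin 4) :
    divV S 0 x z (Sum.inl μ) (Sum.inl ν) =
      c * M x z (Sum.inl μ) (Sum.inl ν) * ((if z = 0 then (1 : ℝ) else 0) - (if x = 0 then (1 : ℝ) else 0)) := by
  rw [h, Pi.smul_apply, Pi.smul_apply, Pi.smul_apply, Pi.smul_apply, smul_eq_mul, conjV_diagK_apply, ffK_inl_inl, legInd_inl, legInd_inl]
  ring

/-- [folklore] **(h4) FROM DECAY**: `Decays M CM δM` localises the column and the row of `M` through `0`. -/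
theorem col_row_of_decays (hM : Decays M CM δM) :
    (∀ (x : Site 4) (μ ν : Fin 4), |M x 0 (Sum.inl μ) (Sum.inl ν)| ≤ CM * Real.exp (-δM * l1 x)) ∧
      (∀ (z : Site 4) (μ ν : Fin 4), |M 0 z (Sum.inl μ) (Sum.inl ν)| ≤ CM * Real.exp (-δM * l1 z)) := by
  refine ⟨fun x μ ν => ?_, fun z μ ν => ?_⟩
  · have h := hM x 0 (Sum.inl μ) (Sum.inl ν)
    rwa [sub_zero] at h
  · have h := hM 0 z (Sum.inl μ) (Sum.inl ν)
    rwa [l1_sub_symm, sub_zero] at h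

end Bridges

/-! ## §5 Instance check: an2's level-0 Wilson table reproduces `wardGerm_wilsonA`, and the `d*d` window's quadratic germ is computed -/

section Wilson

/-- [folklore] (h2) for `wilsonA 3` (an2's `wilsonA_translate` at base point `0`). -/
theorem wilsonA_cov (lam : Fin 4) (v : Site 4) : wilsonA 3 lam v = shiftK (-v) (wilsonA 3 lam 0) := by
  have h := wilsonA_translate (d := 3) lam 0 v
  rwa [zero_add] at h

/-- [folklore] (h3) for `wilsonA 3`: the divergence law at `0` with `c = ½` and `M = bhK 1` (`WilsonDivergenceContact.divV_wilsonA_inl_inl` + the `d*d`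
window entry `bhK_inl_inl_eq`). -/
theorem wilsonA_law (x z : Site 4) (μ ν : Fin 4) :
    divV (wilsonA 3) 0 x z (Sum.inl μ) (Sum.inl ν) =
      (1 / 2 : ℝ) * bhK (d := 3) 1 x z (Sum.inl μ) (Sum.inl ν) * ((if z = 0 then (1 : ℝ) else 0) - (if x = 0 then (1 : ℝ) else 0)) := by
  rw [divV_wilsonA_inl_inl, bhK_inl_inl_eq]

/-- [our object] **THE WILSON INSTANCE OF THE BRIDGE**: `WardGerm (cubicGermOf (wilsonA 3)) (½ · quadMomentOf (bhK 1))` — hypotheses (h1)–(h5) discharged BY NAME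
(`locStencil_wilsonA`, `wilsonA_translate`, `divV_wilsonA_inl_inl`, `decays_bhK`, `tsum_wilsonA_eq_zero`). -/
theorem wardGerm_wilsonA_of_law : WardGerm (cubicGermOf (wilsonA 3)) (fun k μ ν => (1 / 2 : ℝ) * quadMomentOf (bhK (d := 3) 1) k μ ν) := by
  have hS : LocStencil (wilsonA 3) (wBound 3 * Real.exp (4 * 1)) 1 := locStencil_wilsonA (d := 3) zero_le_one
  have hM := col_row_of_decays (decays_bhK (d := 3) (N := 1) le_rfl zero_le_one)
  exact wardGerm_cubicGermOf_of_law hS one_pos wilsonA_cov wilsonA_law hM.1 hM.2 one_pos tsum_wilsonA_eq_zero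

/-- [our object] **THE COMPUTED NORMALISATION**: the quadratic germ of the `d*d` window `bhK 1`, halved, IS the canonical transverse germ:
`½ · quadMomentOf (bhK 1) k μ ν = quadGerm 1 0 0 k μ ν` (`= |k|²δ_{μν} − k_μk_ν`) — from the two Ward partners `wardGerm_wilsonA_of_law` and p236459's
`wardGerm_wilsonA` of the one germ `cubicGermOf (wilsonA 3) = ymGerm` (`CubicGermPairing.quad_eq_of_wardGerm`). -/
theorem half_quadMomentOf_bhK (k : Fin 4 → ℝ) (μ ν : Fin 4) : (1 / 2 : ℝ) * quadMomentOf (bhK (d := 3) 1) k μ ν = quadGerm 1 0 0 k μ ν :=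
  quad_eq_of_wardGerm (Q := fun k μ ν => (1 / 2 : ℝ) * quadMomentOf (bhK (d := 3) 1) k μ ν) wardGerm_wilsonA_of_law wardGerm_wilsonA
    (fun μ ν => by simp only [quadMomentOf_zero, mul_zero]) (fun μ ν => quadGerm_zero μ ν) k μ ν

/-- [our object] (v1.1) BY-PRODUCT — **THE `d*d` WINDOW HAS NO FIRST COLUMN MOMENT**: `∑'_x bhK 1 x 0 (inl μ) (inl ν) · x_κ = 0`, READ OFF the Wilson cubic table
(`tsum_zeroth_eq_col` at the instance: the zeroth moment of `wilsonA 3` vanishes, `WilsonCubicGerm.tsum_wilsonA_eq_zero`, and equals `−½ ×` this moment) — so the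
level-0 Hessian block satisfies letter (h5) of the H2-G checklist. -/
theorem tsum_bhK_fst_moment_eq_zero (κ μ ν : Fin 4) : ∑' x : Site 4, bhK (d := 3) 1 x 0 (Sum.inl μ) (Sum.inl ν) * (x κ : ℝ) = 0 := by
  have hS : LocStencil (wilsonA 3) (wBound 3 * Real.exp (4 * 1)) 1 := locStencil_wilsonA (d := 3) zero_le_one
  have hM := col_row_of_decays (decays_bhK (d := 3) (N := 1) le_rfl zero_le_one)
  have h := tsum_zeroth_eq_col hS one_pos wilsonA_cov wilsonA_law hM.1 hM.2 one_pos κ μ ν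
  rw [tsum_wilsonA_eq_zero] at h
  linarith

end Wilson

end Summit.QuantumFields.BalabanUV.Beta.FP.CubicGermWard
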